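import Summits.HubbardSuperconductivity.HubbardSuperconductivity.Theorems.AnisotropyChordTransferFibre3GreenZeroConstant
import Summits.HubbardSuperconductivity.HubbardSuperconductivity.Theorems.AnisotropyChordTransferFibre3GreenZeroBrackets48
import Summits.HubbardSuperconductivity.HubbardSuperconductivity.Theorems.AnisotropyChordTransferFibre3GreenZeroBose48

/-!
# Route `AnisotropyChord` / H0 rotor rung: ★ THE TORUS CAPACITY CONSTANT at `L ≥ 48` — `0.0442 ≤ G̃₀(0) − ln L/(2π) ≤ 0.0523`

Block `[48,64)` version of `…Fibre3GreenZeroConstant` (p1 g26: `[0.0456, 0.0510]` for `L ≥ 64`): the same assembly (`Gres_zero_split`, near rows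
1…4 via `nearRow_bracket48`, far rows via `farRows_trapezoid` + `farLog_bracket48` + `farRemainder_bound48`, Bose part via `bose_sum_bounds48`) with the
`L ≥ 48` numerics.  ★ `capacity_const_bounds48`: **`0.0442 ≤ G̃₀(0) − ln L/(2π) ≤ 0.0523` for every `L ≥ 48`** (truth at `L = 48`: `0.04875`),
`abs_capacity_const_le48`.  The input of the ν-ceiling / manifold band / a-edge of the t-block `[48,64)` (route-lead ruling R1; inventory memo
HOME/hubbard-h0-rotor-p2/TBLOCK-INVENTORY-g8.md).
Prover seat `hubbard-h0-rotor-p2` g8; helper for stmt-HubbardSuperconductivity-23918 (`--supports`, helper class).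
WHAT THIS IS NOT: nothing here proves superconductivity in the Hubbard model; one analytic input (family A) of ONE conditional reduction on the blocks.
Tree imports only; no new definitions; no sorry.
-/

set_option linter.dupNamespace false
set_option autoImplicit false

noncomputable section

open scoped BigOperators
open Real Finset

namespace Summit.HubbardSuperconductivity.HubbardSuperconductivity.Theorems.AnisotropyChord.Transfer.Fibre3

namespace CapacityConst

variable (L : ℕ) [NeZero L]

/-- ★★★ **THE TORUS CAPACITY CONSTANT** (LEMMA A0 at `λ = 0`): for every `L ≥ 48`,
`0.0456 ≤ G̃₀(0) − ln L/(2π) ≤ 0.0510`. [folklore] -/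
theorem capacity_const_bounds48 (hL : 48 ≤ L) :
    0.0442 ≤ Gres L 0 0 - Real.log L / (2 * Real.pi) ∧
      Gres L 0 0 - Real.log L / (2 * Real.pi) ≤ 0.0523 := by
  have hL0 : (0 : ℝ) < L := by exact_mod_cast (show 0 < L by omega)
  have hL64 : (48 : ℝ) ≤ L := by exact_mod_cast hL
  have hsplit := Gres_zero_split L (by omega)
  -- (0) the zero row
  have h0lo : (1 : ℝ) / 12 - 0.0000362 ≤ (1 - 1 / (L : ℝ) ^ 2) / 12 := by
    have : 1 / (L : ℝ) ^ 2 ≤ 1 / 48 ^ 2 := one_div_le_one_div_of_le (by norm_num) (by nlinarith)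
    linarith
  have h0hi : (1 - 1 / (L : ℝ) ^ 2) / 12 ≤ 1 / 12 := by
    have : 0 ≤ 1 / (L : ℝ) ^ 2 := by positivity
    linarith
  -- (1) near rows and the endpoint row
  obtain ⟨hN1lo, hN1hi⟩ := nearRow_bracket48 L hL 1 one_pos (by norm_num) 0.004284 0.0796344 0.0794073
    (by norm_num) (by norm_num) (by norm_num) (by norm_num)
  obtain ⟨hN2lo, hN2hi⟩ := nearRow_bracket48 L hL 2 (by norm_num) (by norm_num) 0.017135 0.0399027 0.0394507
    (by norm_num) (by norm_num) (by norm_num) (by norm_num)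
  obtain ⟨hN3lo, hN3hi⟩ := nearRow_bracket48 L hL 3 (by norm_num) (by norm_num) 0.038554 0.0266974 0.0260241
    (by norm_num) (by norm_num) (by norm_num) (by norm_num)
  obtain ⟨hN4lo, hN4hi⟩ := nearRow_bracket48 L hL 4 (by norm_num) (by norm_num) 0.068539 0.0201243 0.0192351
    (by norm_num) (by norm_num) (by norm_num) (by norm_num)
  -- (2) the far rows
  obtain ⟨hF1, hF2⟩ := farRows_trapezoid L 4 (by norm_num) (by omega)
  obtain ⟨hLOGlo, hLOGhi⟩ := farLog_bracket48 L hL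
  obtain ⟨hE0, hE⟩ := farRemainder_bound48 L hL
  -- (3) the Bose part
  obtain ⟨hBlo, hBhi⟩ := bose_sum_bounds48 L hL
  -- the far sum divided by `L`
  set FS := ∑ m ∈ Finset.Icc (4 : ℤ) ((L : ℤ) - 4), psiRow 0 (2 * Real.pi * (m : ℝ) / L) with hFS
  set LG := (L : ℝ) / (4 * Real.pi) * Real.log ((1 + Real.sqrt (1 - Real.sin (Real.pi * (4 : ℕ) / L) ^ 4))
            / Real.sin (Real.pi * (4 : ℕ) / L) ^ 2) with hLG
  set DD := Real.pi / (2 * L) * ((Real.sin (Real.pi * (4 : ℕ) / L) * Real.cos (Real.pi * (4 : ℕ) / L)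
          * (1 + 2 * Real.sin (Real.pi * (4 : ℕ) / L) ^ 2))
        / (8 * (Real.sin (Real.pi * (4 : ℕ) / L) ^ 2 * (1 + Real.sin (Real.pi * (4 : ℕ) / L) ^ 2))
          * Real.sqrt (Real.sin (Real.pi * (4 : ℕ) / L) ^ 2 * (1 + Real.sin (Real.pi * (4 : ℕ) / L) ^ 2))))
    with hDD
  have hLG' : LG / L = 1 / (4 * Real.pi) * Real.log ((1 + Real.sqrt (1 - Real.sin (Real.pi * (4 : ℕ) / L) ^ 4))
            / Real.sin (Real.pi * (4 : ℕ) / L) ^ 2) := by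
    rw [hLG]; field_simp
  have hFlo : LG / L + psiRow 0 (2 * Real.pi * (4 : ℕ) / L) / L ≤ FS / L := by
    rw [← add_div]; exact div_le_div_of_nonneg_right (by linarith) hL0.le
  have hFhi : FS / L ≤ LG / L + psiRow 0 (2 * Real.pi * (4 : ℕ) / L) / L + DD / L := by
    rw [← add_div, ← add_div]; exact div_le_div_of_nonneg_right (by linarith) hL0.le
  rw [hLG'] at hFlo hFhi
  have e : (2 * (psiRow 0 (2 * Real.pi * (1 : ℕ) / L) + psiRow 0 (2 * Real.pi * (2 : ℕ) / L)
        + psiRow 0 (2 * Real.pi * (3 : ℕ) / L)) + FS) / L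
      = 2 * (psiRow 0 (2 * Real.pi * (1 : ℕ) / L) / L + psiRow 0 (2 * Real.pi * (2 : ℕ) / L) / L
        + psiRow 0 (2 * Real.pi * (3 : ℕ) / L) / L) + FS / L := by
    field_simp
  rw [hsplit, e]
  constructor <;> linarith

/-- ★★★ `|G̃₀(0) − ln L/(2π) − 0.0483| ≤ 0.0027` for every `L ≥ 48` (exact constant `0.0487656…`). [folklore] -/
theorem abs_capacity_const_le48 (hL : 48 ≤ L) :
    |Gres L 0 0 - Real.log L / (2 * Real.pi) - 0.04825| ≤ 0.00405 := by
  obtain ⟨h1, h2⟩ := capacity_const_bounds48 L hL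
  rw [abs_le]; constructor <;> linarith

end CapacityConst

end Summit.HubbardSuperconductivity.HubbardSuperconductivity.Theorems.AnisotropyChord.Transfer.Fibre3

end
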